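import Summits.Parity.GeneralizedHardyLittlewood.Theorems.DicksonFibrationDimOneStubPrimeClassSumsAux1
import HarnessLib

/-!
# Route `DicksonFibration`, crux `DimOne` (stmt-Parity-0819), line `birth` (sieve-model reshape):
# the stub `stub_primeClassSums` — class sums of `Λ` along a form, averaged over square-free moduli
# with root-count weights (Bombieri–Vinogradov)

The registered stub `stub_primeClassSums : PrimeClassSums` of the vocabulary file
`Theorems/DicksonFibrationDimOneDefs.lean`: for `B, A` there are `C, x₀` such that for `x ≥ x₀`, every
`F ∈ ℤ[X]` with `ω_F(p) ≤ B` at all primes, every form `a m + b` (`a ≠ 0`, `(a, b) = 1`) which is `≥ 1`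
and `≤ x` on the integer interval `I = [m₁, m₂]`, and every `D` with `|a| D ≤ x^{1/4}`,

  `∑_{d ≤ D squarefree} ∑_{s mod d : d ∣ F(s), (a s + b, d) = 1}
     |∑_{m ∈ I, m ≡ s (d)} Λ(a m + b) − |a| · #I/φ(|a| d)| ≤ C x/(log x)^A`.

Proof (the Liouville template is `AbsoluteUpgrade.classSums_le`): the inner sum is
`ψ(V₂; q, r) − ψ(V₁; q, r)` over the REDUCED class `r = a s + b` modulo `q = |a| d` in one value interval
`(V₁, V₂] ⊆ (0, x]` with `|(V₂ − V₁) − |a| #I| ≤ |a|` (`AbsoluteUpgrade.exists_value_interval`), hence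
within `2 E*(x; |a| d) + |a|/φ(|a| d)` of `|a| #I/φ(|a| d)` (helper file 1,
`abs_classSum_vonMangoldt_sub_le`); at most `ω_F(d) ≤ B^{ω(d)}` classes per modulus; Cauchy–Schwarz
`∑_d ω_F(d) E*(x; |a| d) ≤ (∑_d ω_F(d)² E*)^{1/2} (∑_d E*)^{1/2}` with the trivial bound
`E*(x; q) ≤ 12 x (log x)²/q`, the weights `∑_{d ≤ D} B^{2ω(d)}/d ≤ e^{10B²} (log x)^{2B²}`, and
Bombieri–Vinogradov `∑_{q ≤ x^{1/4}} E*(x; q) ≤ C₀ x/(log x)^{2B² + 2 + 2A}` over the DISTINCT moduli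
`|a| d ≤ x^{1/4}` (helper file 1, `bv_primeAPError_quarter`, from the tree's PROVED
`BombieriVinogradovStatement_holds`); the length defects total `≤ 4 e^{10B} (log x)^{2B+2} ≤ x/(log x)^A`.

References: H. Iwaniec, E. Kowalski, *Analytic Number Theory* (2004), Thm. 17.1 [IwaniecKowalski2004];
H. Halberstam, H.-E. Richert, *Sieve Methods* (1974), Ch. 2 and §5.7 [HalberstamRichert1974].
-/

noncomputable section

open scoped BigOperators Classical
open Finset Filter Literature.NumberTheory.Sieve
open scoped ArithmeticFunction.vonMangoldt ArithmeticFunction.omega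
open Summit.Parity.GeneralizedHardyLittlewood.Theorems.AbsoluteUpgrade

namespace Summit.Parity.GeneralizedHardyLittlewood.Cruxes.DimOne.BirthSieve

/-- **Class sums of `Λ` along a form, averaged over square-free moduli with root-count weights
(`stub_primeClassSums`).** For `B, A` there are `C, x₀` such that for `x ≥ x₀`, every `F ∈ ℤ[X]` with
`ω_F(p) ≤ B` at all primes, every form `a m + b` (`a ≠ 0`, `(a, b) = 1`) which is `≥ 1` and `≤ x` on
the integer interval `[m₁, m₂]`, and every `D` with `|a| D ≤ x^{1/4}`:
`∑_{d ≤ D squarefree} ∑_{s mod d : d ∣ F(s), (a s + b, d) = 1}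
   |∑_{m ∈ [m₁, m₂], m ≡ s (d)} Λ(a m + b) − |a| · #[m₁, m₂]/φ(|a| d)| ≤ C x/(log x)^A`.
Proof: the inner sum is `ψ(V₂; q, r) − ψ(V₁; q, r)` over the reduced class `r = a s + b` modulo
`q = |a| d` in one value interval `(V₁, V₂] ⊆ (0, x]` with `|(V₂ − V₁) − |a| #[m₁, m₂]| ≤ |a|`
(`AbsoluteUpgrade.exists_value_interval`), so it is within `2 E*(x; |a| d) + |a|/φ(|a| d)` of the
expected mass; there are `≤ ω_F(d) ≤ B^{ω(d)}` classes; Cauchy–Schwarz with the trivial bound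
`E*(x; q) ≤ 3 x (1 + log x)²/q` and `∑_{d ≤ D} B^{2ω(d)}/d ≪ (log x)^{2B²}`, and Bombieri–Vinogradov
`∑_{q ≤ x^{1/4}} E*(x; q) ≪ x/(log x)^{2A + 2B² + 2}` (tree: `BombieriVinogradovStatement_holds`).
[cite: IwaniecKowalski2004, Theorem 17.1] -/
theorem stub_primeClassSums : PrimeClassSums := by
  intro B A
  -- constants
  obtain ⟨A', hA'⟩ : ∃ A' : ℕ, A' = 2 * B ^ 2 + 2 + 2 * A := ⟨_, rfl⟩
  obtain ⟨C₀, x₀, hC₀, hbv⟩ := bv_primeAPError_quarter (A' : ℝ) (by rw [hA']; positivity)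
  set c₀ : ℝ := Real.sqrt (12 * Real.exp (10 * (B : ℝ) ^ 2) * C₀) with hc₀
  have hc₀0 : 0 ≤ c₀ := Real.sqrt_nonneg _
  obtain ⟨x₁, hx₁⟩ := Filter.eventually_atTop.1 ((Filter.eventually_ge_atTop x₀).and
    ((Filter.eventually_ge_atTop (3 : ℝ)).and
      (eventually_const_mul_log_pow_le (4 * Real.exp (10 * B)) (2 * B + 2 + A))))
  refine ⟨2 * c₀ + 1, x₁, fun x hx F hF a b m₁ m₂ ha hab hm hpos hlex D hD => ?_⟩
  obtain ⟨hxx₀, hx3, hnum⟩ := hx₁ x hx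
  have hx0 : 0 < x := by linarith
  have hx1 : 1 ≤ x := by linarith
  set L := Real.log x with hL
  have hL1 : 1 ≤ L := by
    rw [hL, Real.le_log_iff_exp_le hx0]
    have := Real.exp_one_lt_d9
    linarith
  have hL0 : 0 < L := by linarith
  -- the form and its value interval
  set α : ℕ := a.natAbs with hα
  have hα1 : 0 < α := Int.natAbs_pos.mpr ha
  have hα0 : (0 : ℝ) < α := by exact_mod_cast hα1
  obtain ⟨V₁, V₂, hV, ⟨mstar, hmstar, hV₂⟩, hLam⟩ := exists_value_interval ha hm hpos
  have hV₂x : ((V₂ : ℕ) : ℝ) ≤ x := by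
    have h1 := hlex mstar hmstar
    rw [← hV₂] at h1
    exact_mod_cast h1
  -- the level
  have hx4x : x ^ (1 / 4 : ℝ) ≤ x := by
    conv_rhs => rw [← Real.rpow_one x]
    exact Real.rpow_le_rpow_of_exponent_le hx1 (by norm_num)
  have hDx : ((D : ℕ) : ℝ) ≤ x := by
    refine le_trans ?_ (hD.trans hx4x)
    exact_mod_cast Nat.le_mul_of_pos_left D hα1
  set 𝒟 := (Icc 1 D).filter Squarefree with h𝒟
  have hmem𝒟 : ∀ d ∈ 𝒟, 0 < d ∧ d ≤ D ∧ Squarefree d := fun d hd => by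
    rw [h𝒟, Finset.mem_filter, Finset.mem_Icc] at hd
    exact ⟨hd.1.1, hd.1.2, hd.2⟩
  have hαd : ∀ d ∈ 𝒟, 0 < α * d ∧ ((α * d : ℕ) : ℝ) ≤ x := fun d hd => by
    obtain ⟨hd1, hdD, -⟩ := hmem𝒟 d hd
    refine ⟨Nat.mul_pos hα1 hd1, le_trans ?_ (hD.trans hx4x)⟩
    exact_mod_cast Nat.mul_le_mul_left α hdD
  set D' : ℕ := max D 2 with hD'
  have hD'2 : 2 ≤ D' := le_max_right _ _
  have hD'x : ((D' : ℕ) : ℝ) ≤ x := by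
    rw [hD']
    rcases le_total D 2 with h | h
    · rw [max_eq_right h]; norm_num; linarith
    · rw [max_eq_left h]; exact hDx
  have hsub𝒟 : 𝒟 ⊆ Icc 1 D' := fun d hd => by
    obtain ⟨hd1, hdD, -⟩ := hmem𝒟 d hd
    exact Finset.mem_Icc.mpr ⟨hd1, hdD.trans (le_max_left _ _)⟩
  -- weights
  set ρ : ℕ → ℝ := fun d => (polyRootCountMod ![F] d : ℝ) with hρ
  have hρ0 : ∀ d, 0 ≤ ρ d := fun d => Nat.cast_nonneg _
  have hρB : ∀ d ∈ 𝒟, ρ d ≤ (B : ℝ) ^ ω d := fun d hd =>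
    rootCount_le_pow_omega hF (hmem𝒟 d hd).2.2
  have hLpow : ∀ n : ℕ, Real.exp (2 * (n : ℝ) * Real.log L) = L ^ (2 * n) := fun n => by
    rw [← exp_natMul_log hL0]; congr 1; push_cast; ring
  have hWB : ∑ d ∈ 𝒟, (B : ℝ) ^ ω d / d ≤ Real.exp (10 * B) * L ^ (2 * B) := by
    calc ∑ d ∈ 𝒟, (B : ℝ) ^ ω d / d ≤ ∑ d ∈ Icc 1 D', (B : ℝ) ^ ω d / d :=
          Finset.sum_le_sum_of_subset_of_nonneg hsub𝒟 fun d _ _ => by positivity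
      _ ≤ Real.exp (10 * B) * Real.exp (2 * B * Real.log L) :=
          sum_pow_omega_div_le_exp (Nat.cast_nonneg B) hD'2 hD'x
      _ = Real.exp (10 * B) * L ^ (2 * B) := by rw [hLpow]
  have hWB2 : ∑ d ∈ 𝒟, ((B : ℝ) ^ 2) ^ ω d / d ≤ Real.exp (10 * (B : ℝ) ^ 2) * L ^ (2 * B ^ 2) := by
    calc ∑ d ∈ 𝒟, ((B : ℝ) ^ 2) ^ ω d / d ≤ ∑ d ∈ Icc 1 D', ((B : ℝ) ^ 2) ^ ω d / d :=
          Finset.sum_le_sum_of_subset_of_nonneg hsub𝒟 fun d _ _ => by positivity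
      _ ≤ Real.exp (10 * (B : ℝ) ^ 2) * Real.exp (2 * (B : ℝ) ^ 2 * Real.log L) :=
          sum_pow_omega_div_le_exp (by positivity) hD'2 hD'x
      _ = Real.exp (10 * (B : ℝ) ^ 2) * L ^ (2 * B ^ 2) := by
          have := hLpow (B ^ 2); push_cast at this; rw [this]
  -- the length of the value interval: `|α #I − (V₂ − V₁)| ≤ α`
  have hcardI : (#((Ioc V₁ V₂).filter (fun v : ℕ => (v : ℤ) ≡ b [ZMOD ((α : ℕ) : ℤ)])) : ℝ) =
      (#(Icc m₁ m₂) : ℝ) := by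
    have h1 := hLam 1 Nat.one_pos 0 (fun _ => (1 : ℝ))
    simp only [Finset.sum_const, nsmul_eq_mul, mul_one, mul_zero, zero_add, Nat.cast_one] at h1
    rw [Finset.filter_true_of_mem (fun m _ => Int.modEq_one)] at h1
    exact h1.symm
  have hlen : |(α : ℝ) * (#(Icc m₁ m₂) : ℝ) - (((V₂ : ℕ) : ℝ) - V₁)| ≤ α := by
    have hcount := abs_card_filter_Ioc_intModEq_sub_le hα1 b hV
    rw [← hcardI]
    have e : (α : ℝ) * (#((Ioc V₁ V₂).filter (fun v : ℕ => (v : ℤ) ≡ b [ZMOD ((α : ℕ) : ℤ)])) : ℝ) -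
        (((V₂ : ℕ) : ℝ) - V₁) =
        α * ((#((Ioc V₁ V₂).filter (fun v : ℕ => (v : ℤ) ≡ b [ZMOD ((α : ℕ) : ℤ)])) : ℝ) -
          (((V₂ : ℕ) : ℝ) - V₁) / α) := by
      field_simp
    rw [e, abs_mul, abs_of_pos hα0]
    calc (α : ℝ) * _ ≤ α * 1 := mul_le_mul_of_nonneg_left hcount hα0.le
      _ = α := mul_one _
  -- one class
  have hclass : ∀ d ∈ 𝒟, ∀ s ∈ (rootsMod F d).filter (fun s : ℕ => Int.gcd (a * s + b) d = 1),
      |∑ m ∈ (Icc m₁ m₂).filter (fun m : ℤ => m ≡ (s : ℤ) [ZMOD d]), intVonMangoldt (a * m + b) -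
          (α : ℝ) * (#(Icc m₁ m₂) : ℝ) / (Nat.totient (α * d) : ℝ)| ≤
        2 * primeAPError x (α * d) + (α : ℝ) / (Nat.totient (α * d) : ℝ) := by
    intro d hd s hs
    obtain ⟨hd1, -, -⟩ := hmem𝒟 d hd
    obtain ⟨hq0, hqx⟩ := hαd d hd
    have hgcd : Int.gcd (a * s + b) d = 1 := (Finset.mem_filter.mp hs).2
    have hcop : IsCoprime (a * (s : ℤ) + b) (((α * d : ℕ) : ℤ)) := by
      rw [hα]; exact isCoprime_form_natAbs_mul hab hgcd
    have hinner : ∑ m ∈ (Icc m₁ m₂).filter (fun m : ℤ => m ≡ (s : ℤ) [ZMOD d]),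
        intVonMangoldt (a * m + b) =
        ∑ v ∈ (Ioc V₁ V₂).filter
          (fun v : ℕ => (v : ℤ) ≡ a * (s : ℤ) + b [ZMOD ((α * d : ℕ) : ℤ)]), (Λ v : ℝ) :=
      hLam d hd1 s (fun v => (Λ v : ℝ))
    have hφ0 : (0 : ℝ) < Nat.totient (α * d) := by exact_mod_cast Nat.totient_pos.mpr hq0
    have hper := abs_classSum_vonMangoldt_sub_le hq0 hcop hV hV₂x
    have hsplit : ∑ v ∈ (Ioc V₁ V₂).filter
          (fun v : ℕ => (v : ℤ) ≡ a * (s : ℤ) + b [ZMOD ((α * d : ℕ) : ℤ)]), (Λ v : ℝ) -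
          (α : ℝ) * (#(Icc m₁ m₂) : ℝ) / (Nat.totient (α * d) : ℝ) =
        (∑ v ∈ (Ioc V₁ V₂).filter
          (fun v : ℕ => (v : ℤ) ≡ a * (s : ℤ) + b [ZMOD ((α * d : ℕ) : ℤ)]), (Λ v : ℝ) -
            (((V₂ : ℕ) : ℝ) - V₁) / (Nat.totient (α * d) : ℝ)) +
          ((((V₂ : ℕ) : ℝ) - V₁) - (α : ℝ) * (#(Icc m₁ m₂) : ℝ)) / (Nat.totient (α * d) : ℝ) := by
      ring
    rw [hinner, hsplit]
    calc _ ≤ |∑ v ∈ (Ioc V₁ V₂).filter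
            (fun v : ℕ => (v : ℤ) ≡ a * (s : ℤ) + b [ZMOD ((α * d : ℕ) : ℤ)]), (Λ v : ℝ) -
              (((V₂ : ℕ) : ℝ) - V₁) / (Nat.totient (α * d) : ℝ)| +
          |((((V₂ : ℕ) : ℝ) - V₁) - (α : ℝ) * (#(Icc m₁ m₂) : ℝ)) / (Nat.totient (α * d) : ℝ)| :=
          abs_add_le _ _
      _ ≤ 2 * primeAPError x (α * d) + (α : ℝ) / (Nat.totient (α * d) : ℝ) := by
          refine add_le_add hper ?_
          rw [abs_div, abs_of_pos hφ0, abs_sub_comm]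
          exact div_le_div_of_nonneg_right hlen hφ0.le
  -- one modulus: at most `ω_F(d)` classes
  have hmod : ∀ d ∈ 𝒟,
      ∑ s ∈ (rootsMod F d).filter (fun s : ℕ => Int.gcd (a * s + b) d = 1),
        |∑ m ∈ (Icc m₁ m₂).filter (fun m : ℤ => m ≡ (s : ℤ) [ZMOD d]), intVonMangoldt (a * m + b) -
          (α : ℝ) * (#(Icc m₁ m₂) : ℝ) / (Nat.totient (α * d) : ℝ)| ≤
        ρ d * (2 * primeAPError x (α * d) + (α : ℝ) / (Nat.totient (α * d) : ℝ)) := by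
    intro d hd
    have h0 : 0 ≤ 2 * primeAPError x (α * d) + (α : ℝ) / (Nat.totient (α * d) : ℝ) :=
      add_nonneg (mul_nonneg (by norm_num) (primeAPError_nonneg _ _))
        (div_nonneg hα0.le (Nat.cast_nonneg _))
    have hcard : (#((rootsMod F d).filter (fun s : ℕ => Int.gcd (a * s + b) d = 1)) : ℝ) ≤ ρ d := by
      have : #((rootsMod F d).filter (fun s : ℕ => Int.gcd (a * s + b) d = 1)) ≤ #(rootsMod F d) :=
        Finset.card_le_card (Finset.filter_subset _ _)
      rw [card_rootsMod] at this
      simp only [hρ]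
      exact_mod_cast this
    calc _ ≤ ∑ _s ∈ (rootsMod F d).filter (fun s : ℕ => Int.gcd (a * s + b) d = 1),
          (2 * primeAPError x (α * d) + (α : ℝ) / (Nat.totient (α * d) : ℝ)) :=
          Finset.sum_le_sum fun s hs => hclass d hd s hs
      _ = (#((rootsMod F d).filter (fun s : ℕ => Int.gcd (a * s + b) d = 1)) : ℝ) *
            (2 * primeAPError x (α * d) + (α : ℝ) / (Nat.totient (α * d) : ℝ)) := by
          rw [Finset.sum_const, nsmul_eq_mul]
      _ ≤ _ := mul_le_mul_of_nonneg_right hcard h0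
  -- (T2) the length defect: `∑_d ρ(d) α/φ(α d) ≤ 4 L² e^{10B} L^{2B}`
  have hT2 : ∑ d ∈ 𝒟, ρ d * ((α : ℝ) / (Nat.totient (α * d) : ℝ)) ≤
      4 * L ^ 2 * (Real.exp (10 * B) * L ^ (2 * B)) := by
    have hαφ : ∀ d ∈ 𝒟, (α : ℝ) / (Nat.totient (α * d) : ℝ) ≤ 4 * L ^ 2 / d := by
      intro d hd
      obtain ⟨hd1, -, -⟩ := hmem𝒟 d hd
      obtain ⟨hq0, hqx⟩ := hαd d hd
      have hd0 : (0 : ℝ) < d := by exact_mod_cast hd1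
      have hq1 : (1 : ℝ) ≤ ((α * d : ℕ) : ℝ) := by exact_mod_cast hq0
      have h1 := natCast_div_totient_le (α * d)
      have hlogq : Real.log ((α * d : ℕ) : ℝ) ≤ L := Real.log_le_log (by linarith) hqx
      have hlogq0 : 0 ≤ Real.log ((α * d : ℕ) : ℝ) := Real.log_nonneg hq1
      have h2 : (1 + Real.log ((α * d : ℕ) : ℝ)) ^ 2 ≤ 4 * L ^ 2 := by
        calc (1 + Real.log ((α * d : ℕ) : ℝ)) ^ 2 ≤ (2 * L) ^ 2 :=
              pow_le_pow_left₀ (by linarith) (by linarith) 2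
          _ = 4 * L ^ 2 := by ring
      have h3 : (α : ℝ) / (Nat.totient (α * d) : ℝ) =
          ((α * d : ℕ) : ℝ) / (Nat.totient (α * d) : ℝ) / d := by
        rw [Nat.cast_mul]
        field_simp
      rw [h3]
      exact div_le_div_of_nonneg_right (h1.trans h2) hd0.le
    calc ∑ d ∈ 𝒟, ρ d * ((α : ℝ) / (Nat.totient (α * d) : ℝ))
        ≤ ∑ d ∈ 𝒟, 4 * L ^ 2 * ((B : ℝ) ^ ω d / d) := by
          refine Finset.sum_le_sum fun d hd => ?_
          have hd0 : (0 : ℝ) < d := by exact_mod_cast (hmem𝒟 d hd).1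
          calc ρ d * ((α : ℝ) / (Nat.totient (α * d) : ℝ)) ≤ (B : ℝ) ^ ω d * (4 * L ^ 2 / d) :=
                mul_le_mul (hρB d hd) (hαφ d hd) (div_nonneg hα0.le (Nat.cast_nonneg _))
                  (by positivity)
            _ = 4 * L ^ 2 * ((B : ℝ) ^ ω d / d) := by ring
      _ = 4 * L ^ 2 * ∑ d ∈ 𝒟, (B : ℝ) ^ ω d / d := by rw [Finset.mul_sum]
      _ ≤ 4 * L ^ 2 * (Real.exp (10 * B) * L ^ (2 * B)) :=
          mul_le_mul_of_nonneg_left hWB (by positivity)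
  -- (T1a) the trivial bound: `∑_d ρ(d)² E*(x; α d) ≤ 12 x L² e^{10B²} L^{2B²}`
  have hT1a : ∑ d ∈ 𝒟, ρ d ^ 2 * primeAPError x (α * d) ≤
      12 * x * L ^ 2 * (Real.exp (10 * (B : ℝ) ^ 2) * L ^ (2 * B ^ 2)) := by
    have hEtriv : ∀ d ∈ 𝒟, primeAPError x (α * d) ≤ 12 * x * L ^ 2 / d := by
      intro d hd
      obtain ⟨hd1, -, -⟩ := hmem𝒟 d hd
      obtain ⟨hq0, hqx⟩ := hαd d hd
      have hd0 : (0 : ℝ) < d := by exact_mod_cast hd1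
      have hq0' : (0 : ℝ) < ((α * d : ℕ) : ℝ) := by exact_mod_cast hq0
      have h1 := primeAPError_le_of_natCast_le hx1 hq0 hqx
      have h2 : (1 + L) ^ 2 ≤ 4 * L ^ 2 := by nlinarith
      calc primeAPError x (α * d) ≤ 3 * x * (1 + L) ^ 2 / ((α * d : ℕ) : ℝ) := h1
        _ ≤ 3 * x * (4 * L ^ 2) / ((α * d : ℕ) : ℝ) := by gcongr
        _ ≤ 3 * x * (4 * L ^ 2) / d := by
            refine div_le_div_of_nonneg_left (by positivity) hd0 ?_
            rw [Nat.cast_mul]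
            exact le_mul_of_one_le_left hd0.le (by exact_mod_cast hα1)
        _ = 12 * x * L ^ 2 / d := by ring
    calc ∑ d ∈ 𝒟, ρ d ^ 2 * primeAPError x (α * d)
        ≤ ∑ d ∈ 𝒟, 12 * x * L ^ 2 * (((B : ℝ) ^ 2) ^ ω d / d) := by
          refine Finset.sum_le_sum fun d hd => ?_
          have hd0 : (0 : ℝ) < d := by exact_mod_cast (hmem𝒟 d hd).1
          calc ρ d ^ 2 * primeAPError x (α * d) ≤ ((B : ℝ) ^ ω d) ^ 2 * (12 * x * L ^ 2 / d) :=
                mul_le_mul (pow_le_pow_left₀ (hρ0 d) (hρB d hd) 2) (hEtriv d hd)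
                  (primeAPError_nonneg _ _) (by positivity)
            _ = 12 * x * L ^ 2 * (((B : ℝ) ^ 2) ^ ω d / d) := by
                rw [← pow_mul, mul_comm (ω d) 2, pow_mul]; ring
      _ = 12 * x * L ^ 2 * ∑ d ∈ 𝒟, ((B : ℝ) ^ 2) ^ ω d / d := by rw [Finset.mul_sum]
      _ ≤ 12 * x * L ^ 2 * (Real.exp (10 * (B : ℝ) ^ 2) * L ^ (2 * B ^ 2)) :=
          mul_le_mul_of_nonneg_left hWB2 (by positivity)
  -- (T1b) Bombieri–Vinogradov: `∑_d E*(x; α d) ≤ C₀ x/L^{A'}` (distinct moduli `α d ≤ x^{1/4}`)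
  have hT1b : ∑ d ∈ 𝒟, primeAPError x (α * d) ≤ C₀ * x / L ^ A' := by
    have hBVsum := hbv x hxx₀
    set Q := ⌊x ^ (1 / 4 : ℝ)⌋₊ with hQ
    have himg : 𝒟.image (fun d => α * d) ⊆ Icc 1 Q := by
      intro q hq
      obtain ⟨d, hd, rfl⟩ := Finset.mem_image.mp hq
      obtain ⟨hd1, hdD, -⟩ := hmem𝒟 d hd
      refine Finset.mem_Icc.mpr ⟨Nat.mul_pos hα1 hd1, Nat.le_floor ?_⟩
      calc ((α * d : ℕ) : ℝ) ≤ ((α * D : ℕ) : ℝ) := by exact_mod_cast Nat.mul_le_mul_left α hdD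
        _ ≤ x ^ (1 / 4 : ℝ) := hD
    have hinj : Set.InjOn (fun d => α * d) ↑𝒟 := fun d₁ _ d₂ _ h =>
      Nat.eq_of_mul_eq_mul_left hα1 h
    calc ∑ d ∈ 𝒟, primeAPError x (α * d)
        = ∑ q ∈ 𝒟.image (fun d => α * d), primeAPError x q := (Finset.sum_image hinj).symm
      _ ≤ ∑ q ∈ Icc 1 Q, primeAPError x q :=
          Finset.sum_le_sum_of_subset_of_nonneg himg fun q _ _ => primeAPError_nonneg x q
      _ ≤ C₀ * x / L ^ (A' : ℝ) := hBVsum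
      _ = C₀ * x / L ^ A' := by rw [Real.rpow_natCast]
  -- (T1) Cauchy–Schwarz: `∑_d ρ(d) E*(x; α d) ≤ c₀ x/L^A`
  have hT1 : ∑ d ∈ 𝒟, ρ d * primeAPError x (α * d) ≤ c₀ * x / L ^ A := by
    have hK : (∑ d ∈ 𝒟, ρ d * primeAPError x (α * d)) ^ 2 ≤ (c₀ * x / L ^ A) ^ 2 := by
      calc (∑ d ∈ 𝒟, ρ d * primeAPError x (α * d)) ^ 2
          ≤ (∑ d ∈ 𝒟, ρ d ^ 2 * primeAPError x (α * d)) * ∑ d ∈ 𝒟, primeAPError x (α * d) :=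
            sq_sum_mul_le fun d _ => primeAPError_nonneg _ _
        _ ≤ (12 * x * L ^ 2 * (Real.exp (10 * (B : ℝ) ^ 2) * L ^ (2 * B ^ 2))) * (C₀ * x / L ^ A') :=
            mul_le_mul hT1a hT1b (Finset.sum_nonneg fun d _ => primeAPError_nonneg _ _)
              (by positivity)
        _ = (c₀ * x / L ^ A) ^ 2 := by
            rw [hc₀, div_pow, mul_pow, Real.sq_sqrt (by positivity), hA']
            have hLA : L ^ (2 * B ^ 2 + 2 + 2 * A) = L ^ (2 * B ^ 2) * L ^ 2 * (L ^ A) ^ 2 := by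
              rw [← pow_mul, ← pow_add, ← pow_add]; congr 1; ring
            rw [hLA]
            field_simp
    have hpos' : 0 ≤ c₀ * x / L ^ A := by positivity
    exact (abs_le_of_sq_le_sq' hK hpos').2
  -- (T2') the numerics `4 e^{10B} L^{2B+2+A} ≤ x`
  have hT2' : 4 * L ^ 2 * (Real.exp (10 * B) * L ^ (2 * B)) ≤ x / L ^ A := by
    rw [le_div_iff₀ (by positivity)]
    calc 4 * L ^ 2 * (Real.exp (10 * B) * L ^ (2 * B)) * L ^ A
        = 4 * Real.exp (10 * B) * L ^ (2 * B + 2 + A) := by rw [pow_add, pow_add]; ring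
      _ ≤ x := hnum
  -- assembly
  calc ∑ d ∈ 𝒟, ∑ s ∈ (rootsMod F d).filter (fun s : ℕ => Int.gcd (a * s + b) d = 1),
        |∑ m ∈ (Icc m₁ m₂).filter (fun m : ℤ => m ≡ (s : ℤ) [ZMOD d]), intVonMangoldt (a * m + b) -
          (α : ℝ) * (#(Icc m₁ m₂) : ℝ) / (Nat.totient (α * d) : ℝ)|
      ≤ ∑ d ∈ 𝒟, ρ d * (2 * primeAPError x (α * d) + (α : ℝ) / (Nat.totient (α * d) : ℝ)) :=
        Finset.sum_le_sum hmod
    _ = 2 * ∑ d ∈ 𝒟, ρ d * primeAPError x (α * d) +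
          ∑ d ∈ 𝒟, ρ d * ((α : ℝ) / (Nat.totient (α * d) : ℝ)) := by
        rw [Finset.mul_sum, ← Finset.sum_add_distrib]
        exact Finset.sum_congr rfl fun d _ => by ring
    _ ≤ 2 * (c₀ * x / L ^ A) + x / L ^ A :=
        add_le_add (mul_le_mul_of_nonneg_left hT1 (by norm_num)) (hT2.trans hT2')
    _ = (2 * c₀ + 1) * x / L ^ A := by ring

end Summit.Parity.GeneralizedHardyLittlewood.Cruxes.DimOne.BirthSieve

end
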